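import Literature.MathematicalPhysics.QuantumFieldTheory.Balaban1983to89.B13WalksOfB9FactorsRealSlice

/-!
# `Balaban1983to89.B13WalksOfB9FactorsReading` — T. Bałaban, *Propagators for lattice gauge theories in a background field*, Commun.
Math. Phys. **99** (1985) 389–434 [Balaban1985BackgroundPropagators] («[13]» of [Balaban1988RG2Cluster]), Thm 3.10 (3.105)–(3.108)
pp. 414–416, (3.42) p. 397, (3.27) p. 395, Thm 3.4 p. 400; *Renormalization group approach to lattice gauge field theories. II*,
Commun. Math. Phys. **116** (1988) 1–22 [Balaban1988RG2Cluster] p. 13 (*"This construction was discussed in [13] for all operators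
determining Δ_k"*), p. 15: THE N06 → N10 OBJECT KNIT ALONG A LOCATED SITE READING — modules 33 (`B13WalksOfB9Factors`) and 39
(`B13WalksOfB9FactorsRealSlice`) MADE GEOMETRY-GENERIC: node N06's Theorem-3.10 letters live on an ARBITRARY [B9] geometry
`g : B9.Geometry` (at NODE 00's record: def-Y's member geometry `B9PinMembersKLevelV1.geo9Y x`, whose sites are index bonds), node
N10's entrywise (3.108)-letters `B13EntrywiseWalks.RawEntryLetters` live on the unit torus `UT Nf` of the [B13] term tower; the two
are joined by a LOCATED READING `loc : g.Site → UT Nf` contracting distances up to a scale (`sℓ·d₁(loc a, loc b) ≤ d(a, b)`), a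
hypothesis here (the dictionary's statement — NODE 00 def-Y ∕ def-B13)

statement-level bookkeeping over published theorems with citation tags; kernel-checked compositions of tree theorems; nothing here is a
claim about the Yang–Mills mass gap.

WHY (cell `pub-ymgap`, D-0062 Track A, in-edge N06 = [B9] → N10 = [B13]; seat `pub-ymgap-dag-n10-c` g11, module 55, file A; trigger
(t-N06-inst ∕ t-N06-real) of `pub-ymgap-dag-n10-c/HANDOFF.md` §g4–§g5).  Since 2026-08-27 node N06's certificate of record
(`Summit…N06AtOpsYNuOfRecordV6EPairM*`, editions 12–14) and its helper `Summit…N06G0LayerFromThm310AtPins(B)` DISPLAY Theorem 3.10's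
schemas for Bałaban's `G_k(U)` — `Local342G ∧ Factors389 ∧ Identities310` of `B9Thm310Whole`, the static data `StaticOK310`, the
Leibniz sizes `Sizes310.Bounded` — at def-Y's members `x`, geometry `geo9Y x`, for every real background `U` of the class (3.35)
(`Reg335`), under «M ≥ M₁, c₃₅Mα₀ ≤ a₁».  Modules 33∕39 consume exactly these schemas but are typed at the one-scale torus geometry
`B9Thm37GlueTorus.torusGeom Nf η L M`.  THIS FILE removes the geometry restriction on the N06 side, so that the knit applies AT N06's
RECORD FACE by name (file B, `Summit…N10EntryLettersOfN06RecordFace`); and it starts, where possible, from N06's CONCLUSION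
`B9Thm310Whole.Conv3107` (Theorem 3.10's (3.107)∕(3.108) for the sum `G(U)` in the block-sup currency of [4] (2.51) — n06-k's
`conv3107_of_local3107`) rather than from the schemas, so that NO walk resummation is redone on the [B13] side.

WHAT THIS FILE PROVES (all `theorem`s; no `def`, no instance, no notation).
§1 `exp_reading_le` (a contracting reading transports exponential decay, rate `δ ↦ δ·sℓ`); ★ `rawEntryLetters_of_hasMajorant_reading`
   — ANY real operator `T` on `X → ℝ` with a [4]-(2.51) block-sup majorant `K ≤ B·e^{−δ d}` over `toB6 g R H` (block map `blk : X →
   g.Site`), read as a complex matrix constant in the configuration, is a `RawEntryLetters` datum on EVERY ball of EVERY configuration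
   space with locations `loc ∘ blk`, rate `δ·sℓ`, constant `B` (module 33 §1 `abs_toMatrix_le_of_hasMajorant` + §1).
§2 ★ `rawEntryLetters_G_of_conv3107_reading` — N06's CONCLUSION `Conv3107 𝔬 R H C δ U` (its first entry: `G(U)` has the majorant
   `C·(L^jη)²·e^{−δ d}`) + a bound `L^jη ≤ ℓ_max` ⟹ N10's entry letters of `M(G(U))`: constant `C·ℓ_max²`, rate `δ·sℓ`.
§3 ★ `rawEntryLetters_G_of_local3107_reading` — the same FROM N06's HYPOTHESIS SCHEMAS (`Local342G`, `Factors389`, `Identities310`,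
   `StaticOK310`, `Sizes310.Bounded K`, [4] (2.61) `Ineq261 d`, «M sufficiently large» `N_F·θ₀M⁻¹·c₁ ≤ ½`) by ONE call of n06-k's
   `conv3107_of_local3107`: constant `const37 d δ₀ α ρ B₀ N N′ C_ℓ K · ℓ_max²`, rate `(1 − 2α)δ₀·sℓ`.
§4 the real slice (module 38 `B13RealSliceEntryLetters`, Nevanlinna's two constants; [B9] Thm 3.4's shape; (3.27) `G = Δ_a⁻¹` as complex
   matrices re-derived inline from `Identities310.inv`, module 39 §1's two lines): ★ `rawEntryLetters_G_of_conv3107_realSlice_reading` (DIRECT road: a complex family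
   `Δ₀` holomorphic with a rate-free bound on the ball which at every REAL configuration `v` IS `M(G(U_v))`, `Conv3107` at every such `U_v`
   ⟹ letters of `Δ₀` on the shrunken ball); ★★ `rawEntryLetters_inv_of_conv3107_realSlice_reading` (INVERSE road: the complexified `Δ_a`,
   holomorphic and `m`-accretive on the ball, which on the real slice IS `M(Δ_a(U_v))`; `Conv3107` + `Identities310` at every real `U_v`
   ⟹ letters of `u ↦ A(u)⁻¹` with genuine `u`-dependence, rate `(1 − λ(r))·δ·sℓ`, constant `(Cℓ_max²)^{1−λ}(max (Cℓ_max²) (2∕m))^{λ}`);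
   `rawEntryLetters_inv_of_conv3107_realSlice_reading_radii` (the consumer's radius literally, `λ ≤ (4∕π)R₀∕(R_an − R₀)`).
HONEST FRAMING: kernel-level dictionary + composition over N06's HYPOTHESIS SCHEMAS ∕ CONCLUSION PREDICATE (inhabited by nobody yet for
Bałaban's operators — GAPS G-B9-05∕06a∕07) and over two located hypotheses that are NOT this seat's to choose: the reading `loc, sℓ, ℓ_max`
(NODE 00's dictionary between def-Y's index bonds and def-B13's torus locations `locΛ`, census class A0) and, in §4, the complexification data
(`hslice`, holomorphy, the rate-free bound ∕ the accretivity margin — [B9] Thm 3.4 ∕ [II] p. 15's analyticity in-edge).  NOTHING of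
Bałaban's is constructed or asserted; neither N06 nor N10 is discharged; count-neutral; no `sorry`, no new named fact; standard axioms;
one finite 𝕋⁴ programme at fixed ε — nothing continuum ∕ ℝ⁴ ∕ OS ∕ mass gap ∕ Clay.
-/

noncomputable section

namespace Literature.MathematicalPhysics.QuantumFieldTheory.Balaban1983to89.B13WalksOfB9FactorsReading

open Metric Set Finset
open scoped Matrix
open Literature.MathematicalPhysics.QuantumFieldTheory.Balaban1983to89
open Literature.MathematicalPhysics.QuantumFieldTheory.Balaban1983to89.B6RandomWalk (HasMajorant Ineq261 c1_nonneg)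
open Literature.MathematicalPhysics.QuantumFieldTheory.Balaban1983to89.B9Thm34Ext (toB6)
open Literature.MathematicalPhysics.QuantumFieldTheory.Balaban1983to89.B9Thm37GlueTorus (tdist1 tdist1_nonneg)
open Literature.MathematicalPhysics.QuantumFieldTheory.Balaban1983to89.B9Thm37Whole (const37)
open Literature.MathematicalPhysics.QuantumFieldTheory.Balaban1983to89.B5TorusCover (UT)
open Literature.MathematicalPhysics.QuantumFieldTheory.Balaban1983to89.B9Thm310Whole
  (Ops310 Factors389 Local342G Identities310 StaticOK310 Sizes310 Conv3107 conv3107_of_local3107)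
open Literature.MathematicalPhysics.QuantumFieldTheory.Balaban1983to89.B13EntrywiseWalks (RawEntryLetters)
open Literature.MathematicalPhysics.QuantumFieldTheory.Balaban1983to89.B13WalksOfB9Factors (abs_toMatrix_le_of_hasMajorant)
open Literature.MathematicalPhysics.QuantumFieldTheory.Balaban1983to89.B13RealSliceEntryLetters
  (RealStructure lam rawEntryLetters_of_realOps rawEntryLetters_inv_of_realSlice lam_radii_le)

variable {X : Type} [Fintype X] [DecidableEq X]
variable {ν : ℕ} {Nf : Fin ν → ℕ} [∀ i, NeZero (Nf i)]
variable {E : Type*} [NormedAddCommGroup E] [NormedSpace ℂ E]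

omit [Fintype X] [DecidableEq X] in
/-- The norm of a real matrix entry read in ℂ is its absolute value. [folklore] -/
private theorem norm_map_ofReal_apply (Mx : Matrix X X ℝ) (x x' : X) :
    ‖(Mx.map (algebraMap ℝ ℂ)) x x'‖ = |Mx x x'| := by
  rw [Matrix.map_apply]
  exact Complex.norm_real _

/-- `const37 ≥ 0` for nonnegative letters (the lineage's sign lemma, restated privately). [folklore] -/
private theorem const37_nonneg' (d : ℕ) {δ₀ α ρ B₀ N N' Cℓ K : ℝ} (hB₀ : 0 ≤ B₀) (hN : 0 ≤ N) (hN' : 0 ≤ N')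
    (hCℓ : 0 ≤ Cℓ) (hK : 0 ≤ K) : 0 ≤ const37 d δ₀ α ρ B₀ N N' Cℓ K := by
  simp only [const37]
  exact mul_nonneg (mul_nonneg (mul_nonneg (by norm_num) hB₀)
    (add_nonneg hN (mul_nonneg (mul_nonneg (mul_nonneg hN' (Real.exp_nonneg _)) hCℓ) hK))) (c1_nonneg d δ₀ α)

/-! ## §1. A located, distance-contracting site reading transports block-sup majorants to N10's torus letters -/

section Reading

variable {g : B9.Geometry} [Fintype g.Site] {R : ℝ} {H : Prop}

omit [Fintype g.Site] in
/-- **DECAY ALONG A CONTRACTING READING**: if `sℓ·d₁(loc a, loc b) ≤ d(a, b)` and `δ ≥ 0` then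
`e^{−δ·d(a,b)} ≤ e^{−(δ·sℓ)·d₁(loc a, loc b)}`. [cite: Balaban1984PropagatorsII, (2.46) p.231 (the multiscale distance); Balaban1985BackgroundPropagators, (3.108) p.416] -/
theorem exp_reading_le {loc : g.Site → UT Nf} {sℓ δ : ℝ} (hδ : 0 ≤ δ)
    (hloc : ∀ a b, sℓ * tdist1 Nf (loc a) (loc b) ≤ g.dist a b) (a b : g.Site) :
    Real.exp (-(δ * g.dist a b)) ≤ Real.exp (-((δ * sℓ) * tdist1 Nf (loc a) (loc b))) := by
  apply Real.exp_le_exp.2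
  have h := mul_le_mul_of_nonneg_left (hloc a b) hδ
  rw [← mul_assoc] at h
  linarith

/-- **A [4]-(2.51) BLOCK-SUP MAJORANT, READ ON THE TORUS, IS AN ENTRYWISE (3.108)-LETTER OF NODE N10.**  For a real operator `T` on
`X → ℝ` with `HasMajorant blk T K` over the transported geometry `toB6 g R H`, a kernel bound `K(a, b) ≤ B·e^{−δ d(a,b)}` (`B, δ ≥ 0`)
and a located reading `loc : g.Site → UT Nf` with `sℓ·d₁(loc a, loc b) ≤ d(a, b)`: the configuration-constant complex family
`u ↦ M(T)` is a `RawEntryLetters` datum with locations `loc ∘ blk`, rate `δ·sℓ`, constant `B`, on every ball (entry bound = module 33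
`abs_toMatrix_le_of_hasMajorant`; holomorphy of a constant). [cite: Balaban1984PropagatorsII, (2.51) p.232; Balaban1985BackgroundPropagators, (3.108) p.416; Balaban1988RG2Cluster, p.13] -/
theorem rawEntryLetters_of_hasMajorant_reading {blk : X → g.Site} {T : Module.End ℝ (X → ℝ)} {K : g.Site → g.Site → ℝ}
    (h : HasMajorant (g := toB6 g R H) blk T K) {B δ : ℝ} (hK : ∀ a b, K a b ≤ B * Real.exp (-(δ * g.dist a b)))
    (hB : 0 ≤ B) (hδ : 0 ≤ δ) (loc : g.Site → UT Nf) {sℓ : ℝ} (hloc : ∀ a b, sℓ * tdist1 Nf (loc a) (loc b) ≤ g.dist a b)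
    (Rball : ℝ) :
    RawEntryLetters (Nf := Nf) (fun (_ : E) => (LinearMap.toMatrix' T).map (algebraMap ℝ ℂ)) (loc ∘ blk) Rball (δ * sℓ) B where
  decay := fun _ _ x x' => by
    rw [norm_map_ofReal_apply]
    calc |LinearMap.toMatrix' T x x'| ≤ K (blk x) (blk x') := abs_toMatrix_le_of_hasMajorant h x x'
      _ ≤ B * Real.exp (-(δ * g.dist (blk x) (blk x'))) := hK _ _
      _ ≤ B * Real.exp (-((δ * sℓ) * tdist1 Nf (loc (blk x)) (loc (blk x')))) :=
          mul_le_mul_of_nonneg_left (exp_reading_le hδ hloc _ _) hB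
  holo := fun _ _ => differentiableOn_const _
  B_nonneg := hB

end Reading

/-! ## §2. From N06's CONCLUSION `Conv3107` (Theorem 3.10 for the sum `G(U)`, block-sup currency) -/

section Ops

variable {g : B9.Geometry} [Fintype g.Site] [DecidableEq g.Site]
variable {Bg : B9.Backgrounds} {Y ι A : Type} [Fintype ι] [Fintype A]
variable (𝔬 : Ops310 g Bg X Y ι A) {Rr : ℝ} {H : Prop}

omit [DecidableEq g.Site] [Fintype ι] [Fintype A] in
/-- **N10's ENTRY LETTERS OF `G(U)` FROM N06's (3.107)∕(3.108)** — *"From (3.108) it follows that the expansion (3.107) is convergent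
in all norms in the inequalities (3.42)–(3.47)"* (p. 416), typed by N06 as `Conv3107 𝔬 R H C δ U` (first entry: the [4]-(2.51)
majorant `C·(L^jη)²·e^{−δ d}` of `G(U)`): along a located reading with `L^jη ≤ ℓ_max` on the member, `M(G(U))` read in ℂ is a
`RawEntryLetters` datum with locations `loc ∘ blk`, rate `δ·sℓ`, constant `C·ℓ_max²` — node N10's NODE-A input shape (junction editions
`…WalksBlockEntrywise ∕ …RealSlice`, binder `hEL` ∕ the real-slice letters) for the piece `G_k(U)` of `Δ_k` at one real background.
[cite: Balaban1985BackgroundPropagators, Thm 3.10 (3.107)–(3.108) p.416, (3.42) p.397; Balaban1988RG2Cluster, p.13, (2.16) p.16] -/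
theorem rawEntryLetters_G_of_conv3107_reading {C δ : ℝ} {U : Bg.Cfg} (hc : Conv3107 𝔬 Rr H C δ U) (hC : 0 ≤ C) (hδ : 0 ≤ δ)
    {ℓmax : ℝ} (hlen0 : ∀ a : g.Site, 0 ≤ g.len a) (hlen : ∀ a : g.Site, g.len a ≤ ℓmax)
    (loc : g.Site → UT Nf) {sℓ : ℝ} (hloc : ∀ a b, sℓ * tdist1 Nf (loc a) (loc b) ≤ g.dist a b) (Rball : ℝ) :
    RawEntryLetters (Nf := Nf) (fun (_ : E) => (LinearMap.toMatrix' (𝔬.G U)).map (algebraMap ℝ ℂ)) (loc ∘ 𝔬.blk) Rball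
      (δ * sℓ) (C * ℓmax ^ 2) :=
  rawEntryLetters_of_hasMajorant_reading hc.1
    (fun a _ => mul_le_mul_of_nonneg_right (mul_le_mul_of_nonneg_left (pow_le_pow_left₀ (hlen0 a) (hlen a) 2) hC)
      (Real.exp_nonneg _))
    (mul_nonneg hC (sq_nonneg _)) hδ loc hloc Rball

/-! ## §3. From N06's HYPOTHESIS SCHEMAS (one call of n06-k's `conv3107_of_local3107`) -/

/-- **N10's ENTRY LETTERS OF `G(U)` FROM N06's TYPED HYPOTHESES OF THEOREM 3.10** — «Cor. 3.6 for all `G_□(U)`» (`Local342G`), the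
(3.89)-type factor bounds (`Factors389`), the structure `GΔ_a = I`, (3.105) (`Identities310`), the static data (`StaticOK310`), the
Leibniz sizes `≤ K`, [4] Lemma 2.1 (2.61) at exponent `d` and «M sufficiently large» LOCATED as `N_F·θ₀M⁻¹·c₁(α) ≤ ½` — along a
located reading: constant `const37 d δ₀ α ρ B₀ N N′ C_ℓ K · ℓ_max²`, rate `(1 − 2α)δ₀·sℓ` (§2 after n06-k's `conv3107_of_local3107`).
[cite: Balaban1985BackgroundPropagators, Thm 3.10 (3.105)–(3.108) pp.414–416, Cor. 3.6 p.408, (3.89) p.409; Balaban1984PropagatorsII, Lemma 2.1 (2.61) p.234, Prop. 2.2 (2.64)–(2.67) p.234] -/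
theorem rawEntryLetters_G_of_local3107_reading [Fintype Y] [DecidableEq Y] (d : ℕ) {δ₀ α ρ B₀ N N' NF Cℓ K θ₀ : ℝ}
    {κ : Sizes310} {U : Bg.Cfg}
    (hB₀ : 0 ≤ B₀) (hδ₀ : 0 ≤ δ₀) (hα : 0 ≤ α) (hα2 : α ≤ 1 / 2) (hN : 0 ≤ N) (hN' : 0 ≤ N') (hNF : 0 ≤ NF)
    (hCℓ : 1 ≤ Cℓ) (hK : 0 ≤ K) (hθ₀ : 0 ≤ θ₀) (hM : 0 < g.M) (hs : StaticOK310 𝔬 ρ N N' NF Cℓ κ) (hκ : κ.Bounded K)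
    (h261 : Ineq261 d (toB6 g Rr H) δ₀ α) (hq : NF * (θ₀ * g.M⁻¹) * B6.c1 d δ₀ α ≤ 1 / 2)
    (hl : Local342G 𝔬 Rr H B₀ δ₀ U) (hf : Factors389 𝔬 Rr H θ₀ δ₀ U) (hi : Identities310 𝔬 Rr H U)
    {ℓmax : ℝ} (hlen : ∀ a : g.Site, g.len a ≤ ℓmax)
    (loc : g.Site → UT Nf) {sℓ : ℝ} (hloc : ∀ a b, sℓ * tdist1 Nf (loc a) (loc b) ≤ g.dist a b) (Rball : ℝ) :
    RawEntryLetters (Nf := Nf) (fun (_ : E) => (LinearMap.toMatrix' (𝔬.G U)).map (algebraMap ℝ ℂ)) (loc ∘ 𝔬.blk) Rball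
      (((1 - 2 * α) * δ₀) * sℓ) (const37 d δ₀ α ρ B₀ N N' Cℓ K * ℓmax ^ 2) :=
  rawEntryLetters_G_of_conv3107_reading 𝔬
    (conv3107_of_local3107 𝔬 Rr H d δ₀ α ρ B₀ N N' NF Cℓ K θ₀ κ U hB₀ hδ₀ hα hα2 hN hN' hNF hCℓ hK hθ₀ hM hs hκ h261 hq hl hf hi)
    (const37_nonneg' d hB₀ hN hN' (zero_le_one.trans hCℓ) hK) (mul_nonneg (by linarith) hδ₀) (fun a => (hs.lenpos a).le)
    hlen loc hloc Rball

/-! ## §4. The real slice: [B9] Thm 3.4's shape by module 38's two constants -/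

omit [DecidableEq g.Site] [Fintype ι] [Fintype A] in
/-- **THE REAL SLICE, DIRECT ROAD** (module 39 §2 along a reading): a real structure `ℛ` on `E`; a complex family `Δ₀ : E → Matrix X X ℂ`
entrywise holomorphic on `‖u‖ < R_an` with a rate-free bound `M_b`; a background `U_v` read at every configuration such that AT EVERY REAL
`v` of the ball N06's conclusion `Conv3107 𝔬 R H C δ U_v` holds with the SAME constants (print: Thm 3.10 uniform over the class (3.35))
and `Δ₀ v = M(G(U_v))` (the dictionary's identification — a hypothesis); `C·ℓ_max² ≤ M_b`.  Then for `0 < r < 1`, `Δ₀` is a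
`RawEntryLetters` datum on `‖u‖ < (r∕(1+r))R_an`, locations `loc ∘ blk`, rate `(1 − λ(r))·(δ·sℓ)`, constant
`(Cℓ_max²)^{1−λ(r)}·M_b^{λ(r)}` (§2 at each real `v`, then module 38 `rawEntryLetters_of_realOps`).
[cite: Balaban1985BackgroundPropagators, Thm 3.4 p.400, Thm 3.10 (3.107)–(3.108) p.416; Balaban1988RG2Cluster, p.13, p.15; Ransford1995, Thm. 4.3.7] -/
theorem rawEntryLetters_G_of_conv3107_realSlice_reading (ℛ : RealStructure E) {Δ₀ : E → Matrix X X ℂ} (Uv : E → Bg.Cfg)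
    {Ran Mb r C δ ℓmax sℓ : ℝ} (hRan : 0 < Ran)
    (hc : ∀ v ∈ ℛ.Ereal, ‖v‖ < Ran → Conv3107 𝔬 Rr H C δ (Uv v)) (hC : 0 ≤ C) (hδ : 0 ≤ δ)
    (hlen0 : ∀ a : g.Site, 0 ≤ g.len a) (hlen : ∀ a : g.Site, g.len a ≤ ℓmax)
    (loc : g.Site → UT Nf) (hsℓ : 0 ≤ sℓ) (hloc : ∀ a b, sℓ * tdist1 Nf (loc a) (loc b) ≤ g.dist a b)
    (hslice : ∀ v ∈ ℛ.Ereal, ‖v‖ < Ran → Δ₀ v = (LinearMap.toMatrix' (𝔬.G (Uv v))).map (algebraMap ℝ ℂ))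
    (hholo : ∀ i j, DifferentiableOn ℂ (fun u => Δ₀ u i j) (ball (0 : E) Ran))
    (hMb : ∀ u ∈ ball (0 : E) Ran, ∀ i j, ‖Δ₀ u i j‖ ≤ Mb) (hBM : C * ℓmax ^ 2 ≤ Mb) (hr0 : 0 < r) (hr1 : r < 1) :
    RawEntryLetters Δ₀ (loc ∘ 𝔬.blk) (r / (1 + r) * Ran) ((1 - lam r) * (δ * sℓ))
      ((C * ℓmax ^ 2) ^ (1 - lam r) * Mb ^ lam r) :=
  rawEntryLetters_of_realOps ℛ (fun v => LinearMap.toMatrix' (𝔬.G (Uv v))) hRan hslice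
    (fun v hv hvR => rawEntryLetters_G_of_conv3107_reading 𝔬 (hc v hv hvR) hC hδ hlen0 hlen loc hloc Ran)
    hholo hMb (mul_nonneg hC (sq_nonneg _)) hBM (mul_nonneg hδ hsℓ) hr0 hr1

omit [DecidableEq g.Site] in
/-- **THE REAL SLICE, [B9] THM 3.4-SHAPED INVERSE ROAD** (module 39 §3 along a reading): the complexified operator family
`A : E → Matrix X X ℂ`, entrywise holomorphic and `m`-accretive on the complex ball (print: *"small perturbations of the operators
depending on U only"*; module 38 `accretive_of_coercive_sub` supplies the margin from real coercivity + small complex deviation), which AT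
EVERY REAL CONFIGURATION of the ball IS N06's `M(Δ_a(U_v))` (`hslice`), with N06's conclusion `Conv3107` and structure `Identities310`
(for `GΔ_a = I`) at every such `U_v` ⟹ `RawEntryLetters (u ↦ A(u)⁻¹)` on `‖u‖ < (r∕(1+r))R_an`, locations `loc ∘ blk`, rate
`(1 − λ(r))·(δ·sℓ)`, constant `(Cℓ_max²)^{1−λ}·(max (Cℓ_max²) (2∕m))^{λ}` — print's `G(U) = (Δ_a|Ω₀)⁻¹` CONTINUED to complex
background with genuine `u`-dependence; on the real slice `A(v)⁻¹ = M(G(U_v))` (§4's identity) carries §2's decay, off it holomorphy and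
the bound `2∕m` come from accretivity (module 38 `rawEntryLetters_inv_of_realSlice`).  No (3.108) at complex background is supplied by hand.
[cite: Balaban1985BackgroundPropagators, (3.24)–(3.27) pp.394–395, Thm 3.4 p.400, (3.50)–(3.53) p.400, Thm 3.10 (3.108) p.416;
Balaban1988RG2Cluster, p.13, p.15; Ransford1995, Thm. 4.3.7] -/
theorem rawEntryLetters_inv_of_conv3107_realSlice_reading (ℛ : RealStructure E) {Aop : E → Matrix X X ℂ} (Uv : E → Bg.Cfg)
    {Ran mA r C δ ℓmax sℓ : ℝ}
    (hc : ∀ v ∈ ℛ.Ereal, ‖v‖ < Ran → Conv3107 𝔬 Rr H C δ (Uv v))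
    (hI : ∀ v ∈ ℛ.Ereal, ‖v‖ < Ran → Identities310 𝔬 Rr H (Uv v)) (hC : 0 ≤ C) (hδ : 0 ≤ δ)
    (hlen0 : ∀ a : g.Site, 0 ≤ g.len a) (hlen : ∀ a : g.Site, g.len a ≤ ℓmax)
    (loc : g.Site → UT Nf) (hsℓ : 0 ≤ sℓ) (hloc : ∀ a b, sℓ * tdist1 Nf (loc a) (loc b) ≤ g.dist a b)
    (hslice : ∀ v ∈ ℛ.Ereal, ‖v‖ < Ran → Aop v = (LinearMap.toMatrix' (𝔬.Δa (Uv v))).map (algebraMap ℝ ℂ))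
    (hA : ∀ i j, DifferentiableOn ℂ (fun u => Aop u i j) (ball (0 : E) Ran)) (hmA : 0 < mA)
    (hacc : ∀ u ∈ ball (0 : E) Ran, ∀ w : X → ℂ, mA * ∑ i, ‖w i‖ ^ 2 ≤ (∑ i, star (w i) * (Aop u *ᵥ w) i).re)
    (hr0 : 0 < r) (hr1 : r < 1) :
    RawEntryLetters (fun u => (Aop u)⁻¹) (loc ∘ 𝔬.blk) (r / (1 + r) * Ran) ((1 - lam r) * (δ * sℓ))
      ((C * ℓmax ^ 2) ^ (1 - lam r) * (max (C * ℓmax ^ 2) (2 / mA)) ^ lam r) := by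
  refine rawEntryLetters_inv_of_realSlice ℛ hmA hA hacc (fun v hv hvR i j => ?_) (mul_nonneg hC (sq_nonneg _))
    (mul_nonneg hδ hsℓ) hr0 hr1
  -- [B9] (3.27) `G(U_v) = (Δ_a(U_v))⁻¹` as complex matrices, from `Identities310.inv` (module 39 §1's two lines, at any geometry)
  have hinv : ((LinearMap.toMatrix' (𝔬.Δa (Uv v))).map (algebraMap ℝ ℂ))⁻¹ =
      (LinearMap.toMatrix' (𝔬.G (Uv v))).map (algebraMap ℝ ℂ) := by
    refine Matrix.inv_eq_left_inv ?_
    rw [← Matrix.map_mul, ← LinearMap.toMatrix'_mul, (hI v hv hvR).inv, LinearMap.toMatrix'_one]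
    exact Matrix.map_one _ (map_zero _) (map_one _)
  -- on the real slice the inverse IS N06's `G(U_v)`, which carries §2's decay at every point of its ball
  rw [hslice v hv hvR, hinv]
  exact (rawEntryLetters_G_of_conv3107_reading (E := E) 𝔬 (hc v hv hvR) hC hδ hlen0 hlen loc hloc 1).decay 0
    (mem_ball_self one_pos) i j

omit [DecidableEq g.Site] in
/-- **RADII EDITION OF THE INVERSE ROAD**: for a target radius `R₀ > 0` (the junction's `rf.R`) and an analyticity radius `R_an > 2R₀`
([II] p. 15: the primed spaces are «much bigger»), the inverse road at `r := R₀∕(R_an − R₀)` gives the letters ON THE BALL OF RADIUS `R₀`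
with rate `(1 − λ)·(δ·sℓ)`, `λ = λ(R₀∕(R_an − R₀)) ≤ (4∕π)·R₀∕(R_an − R₀)` (module 38 `lam_radii_le`).
[cite: Balaban1985BackgroundPropagators, Thm 3.4 p.400, Thm 3.10 (3.108) p.416; Balaban1988RG2Cluster, p.15; Balaban1987RG1, (1.13)–(1.14) p.262; Ransford1995, Thm. 4.3.7] -/
theorem rawEntryLetters_inv_of_conv3107_realSlice_reading_radii (ℛ : RealStructure E) {Aop : E → Matrix X X ℂ}
    (Uv : E → Bg.Cfg) {Ran R₀ mA C δ ℓmax sℓ : ℝ} (hR₀ : 0 < R₀) (h2 : 2 * R₀ < Ran)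
    (hc : ∀ v ∈ ℛ.Ereal, ‖v‖ < Ran → Conv3107 𝔬 Rr H C δ (Uv v))
    (hI : ∀ v ∈ ℛ.Ereal, ‖v‖ < Ran → Identities310 𝔬 Rr H (Uv v)) (hC : 0 ≤ C) (hδ : 0 ≤ δ)
    (hlen0 : ∀ a : g.Site, 0 ≤ g.len a) (hlen : ∀ a : g.Site, g.len a ≤ ℓmax)
    (loc : g.Site → UT Nf) (hsℓ : 0 ≤ sℓ) (hloc : ∀ a b, sℓ * tdist1 Nf (loc a) (loc b) ≤ g.dist a b)
    (hslice : ∀ v ∈ ℛ.Ereal, ‖v‖ < Ran → Aop v = (LinearMap.toMatrix' (𝔬.Δa (Uv v))).map (algebraMap ℝ ℂ))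
    (hA : ∀ i j, DifferentiableOn ℂ (fun u => Aop u i j) (ball (0 : E) Ran)) (hmA : 0 < mA)
    (hacc : ∀ u ∈ ball (0 : E) Ran, ∀ w : X → ℂ, mA * ∑ i, ‖w i‖ ^ 2 ≤ (∑ i, star (w i) * (Aop u *ᵥ w) i).re) :
    RawEntryLetters (fun u => (Aop u)⁻¹) (loc ∘ 𝔬.blk) R₀ ((1 - lam (R₀ / (Ran - R₀))) * (δ * sℓ))
      ((C * ℓmax ^ 2) ^ (1 - lam (R₀ / (Ran - R₀))) *
        (max (C * ℓmax ^ 2) (2 / mA)) ^ lam (R₀ / (Ran - R₀))) ∧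
      lam (R₀ / (Ran - R₀)) ≤ 4 / Real.pi * (R₀ / (Ran - R₀)) := by
  have hd : 0 < Ran - R₀ := by linarith
  have hr0 : 0 < R₀ / (Ran - R₀) := div_pos hR₀ hd
  have hr1 : R₀ / (Ran - R₀) < 1 := (div_lt_one hd).2 (by linarith)
  have h := rawEntryLetters_inv_of_conv3107_realSlice_reading 𝔬 ℛ Uv hc hI hC hδ hlen0 hlen loc hsℓ hloc hslice hA hmA hacc
    hr0 hr1
  have e : R₀ / (Ran - R₀) / (1 + R₀ / (Ran - R₀)) * Ran = R₀ := by
    field_simp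
    ring
  rw [e] at h
  exact ⟨h, lam_radii_le hR₀.le h2⟩

end Ops

end Literature.MathematicalPhysics.QuantumFieldTheory.Balaban1983to89.B13WalksOfB9FactorsReading

end
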